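import Summits.AtomisticToContinuum.Crystallization.Theorems.ChartedZeroExcessLayeredLatticeLiouvilleVB

/-!
# Zero-excess layered lattice Liouville — part VC (lens-2 g57, node «InPlaneShift»): in-plane translation invariance of truncated
harmonicity, difference fields, and the TANGENTIAL H² ESTIMATE uniform over certified laminates.

The layered kernel and the physical cut-off of `IsTruncHarmonicZ` depend on the in-plane cell only through DIFFERENCES
(`lsite (γ + e) m − lsite (γ' + e) m' = lsite γ m − lsite γ' m'`), so the in-plane translate `τ_E φ` (`E = (e, 0)`) of a `ϱ`-truncated-harmonic
field is `ϱ`-truncated-harmonic on the translated set (`isTruncHarmonicZ_latShift`), and so is the DIFFERENCE FIELD `D_E φ = τ_E φ − φ`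
(`isTruncHarmonicZ_latDiff`).  Feeding `D_E φ` to the Caccioppoli inequality of part UZ (free constant `v = 0`) gives the discrete tangential
`H²` interior estimate `caccioppoli_latDiff`:
`κ₀ · idxEnergy (D_E φ) (idxBall x₀ r) ≤ 54·F(c)/(n − r)² · idxEnergy φ (idxBall x₀ (n + ϱ/c + 1))` for in-plane unit steps `E`,
and — since `D_E` of a mode is a constant — its form MODULO MODES `caccioppoli_latDiff_modal` (right-hand side `idxEnergy (φ − M)` for every
`ϱ`-truncated mode `M`).  [giaquinta1984 Ch. II §2 (difference quotients), Ch. III §2] in lattice form; the laminate has no translation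
invariance ACROSS layers, which is where (LD)'s clause (ii) lives.  Bricks of (LD) `LinearExcessDecayZ`; nothing of the column is re-typed,
nothing here is an item.
-/

noncomputable section

open scoped BigOperators InnerProductSpace RealInnerProductSpace
open MeasureTheory Set Metric Filter Topology
open Summit.AtomisticToContinuum.Crystallization.Theorems.ChartedPlanarOrderRigidityDoor (E3 IsNash atomsIn)
open Summit.AtomisticToContinuum.Crystallization.Theorems.ChartedPlanarOrderDensityDichotomy (μS IsSep nK nK_nonneg)
open Summit.AtomisticToContinuum.Crystallization.Theorems.ChartedPlanarOrderDoorLayered (Layered layeredHom_eq_layered)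

namespace Summit.AtomisticToContinuum.Crystallization.Theorems.ChartedZeroExcessLayeredLatticeLiouville

section InPlaneShift

variable {c : ℝ} {a b : E3} {w : ℤ → E3}

/-! ### VC.1  Lattice translates and difference fields -/

/-- the lattice TRANSLATE `τ_E φ (γ, α) = φ (γ + E.1, α + E.2)`. [this file, g57] -/
def latShift (E : Cell 2 × ℤ) (φ : Cell 2 → ℤ → E3) : Cell 2 → ℤ → E3 :=
  fun γ α => φ (γ + E.1) (α + E.2)

/-- the DIFFERENCE FIELD `D_E φ = τ_E φ − φ`. [this file, g57] -/
def latDiff (E : Cell 2 × ℤ) (φ : Cell 2 → ℤ → E3) : Cell 2 → ℤ → E3 :=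
  latShift E φ - φ

/-- Auxiliary step (`latShift apply`). [formal bookkeeping] -/
theorem latShift_apply (E : Cell 2 × ℤ) (φ : Cell 2 → ℤ → E3) (X : Cell 2 × ℤ) :
    latShift E φ X.1 X.2 = φ (X + E).1 (X + E).2 := rfl

/-- Auxiliary step (`latDiff apply`). [formal bookkeeping] -/
theorem latDiff_apply (E : Cell 2 × ℤ) (φ : Cell 2 → ℤ → E3) (X : Cell 2 × ℤ) :
    latDiff E φ X.1 X.2 = φ (X + E).1 (X + E).2 - φ X.1 X.2 := rfl

/-- the squared difference field is part UV's displacement increment. [formal bookkeeping] -/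
theorem norm_latDiff_sq (E : Cell 2 × ℤ) (φ : Cell 2 → ℤ → E3) (X : Cell 2 × ℤ) :
    ‖latDiff E φ X.1 X.2‖ ^ 2 = dispSqFam φ E X := rfl

/-- `D_E` is linear. [formal bookkeeping] -/
theorem latDiff_sub (E : Cell 2 × ℤ) (φ ψ : Cell 2 → ℤ → E3) : latDiff E (φ - ψ) = latDiff E φ - latDiff E ψ := by
  funext γ α
  simp only [latDiff, latShift, Pi.sub_apply]
  abel

/-- the in-plane difference of an `IsAffine` field is a CONSTANT (its in-plane gradient against `E.1`). [this file, g57] -/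
theorem latDiff_const_of_isAffine {M : Cell 2 → ℤ → E3} (hM : IsAffine M) {E : Cell 2 × ℤ} (hE : E.2 = 0) :
    ∃ v : E3, latDiff E M = fun _ _ => v := by
  obtain ⟨g, d, hgd⟩ := hM
  refine ⟨∑ j, ((E.1 j : ℤ) : ℝ) • g j, ?_⟩
  funext γ α
  simp only [latDiff, latShift, Pi.sub_apply, hgd, hE, add_zero, Pi.add_apply, Int.cast_add, add_smul, Finset.sum_add_distrib]
  abel

/-- subtracting a constant field does not change the localised energy. [formal bookkeeping] -/
theorem idxEnergy_sub_const (φ : Cell 2 → ℤ → E3) (v : E3) (B : Set (Cell 2 × ℤ)) :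
    idxEnergy (fun γ α => φ γ α - v) B = idxEnergy φ B := by
  unfold idxEnergy
  simp only [sub_sub_sub_cancel_right]

/-- hence the energy of `D_E (φ − M)` is that of `D_E φ` for affine `M`. [this file, g57] -/
theorem idxEnergy_latDiff_sub_isAffine (φ : Cell 2 → ℤ → E3) {M : Cell 2 → ℤ → E3} (hM : IsAffine M) {E : Cell 2 × ℤ} (hE : E.2 = 0)
    (B : Set (Cell 2 × ℤ)) : idxEnergy (latDiff E (φ - M)) B = idxEnergy (latDiff E φ) B := by
  obtain ⟨v, hv⟩ := latDiff_const_of_isAffine hM hE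
  rw [latDiff_sub, hv]
  exact idxEnergy_sub_const (latDiff E φ) v B

/-! ### VC.2  In-plane translation invariance of truncated harmonicity -/

/-- the site map is equivariant under in-plane cell translation: site DIFFERENCES are unchanged. [this file, g57] -/
theorem lsite_add_sub_lsite_add (a b : E3) (w : ℤ → E3) (γ γ' e : Cell 2) (m m' : ℤ) :
    lsite a b w (γ + e) m - lsite a b w (γ' + e) m' = lsite a b w γ m - lsite a b w γ' m' := by
  simp only [lsite, Pi.add_apply, Int.cast_add, add_smul]
  abel

/-- truncated harmonicity is monotone in the set. [formal bookkeeping] -/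
theorem isTruncHarmonicZ_mono {ϱ : ℝ} {φ : Cell 2 → ℤ → E3} {P Q : Set (Cell 2 × ℤ)} (h : IsTruncHarmonicZ ϱ a b w φ P) (hQP : Q ⊆ P) :
    IsTruncHarmonicZ ϱ a b w φ Q :=
  fun x hx => h x (hQP hx)

/-- truncated harmonicity is linear: differences of harmonic fields are harmonic. [this file, g57] -/
theorem isTruncHarmonicZ_sub {ϱ : ℝ} {φ ψ : Cell 2 → ℤ → E3} {P : Set (Cell 2 × ℤ)} (hφ : IsTruncHarmonicZ ϱ a b w φ P)
    (hψ : IsTruncHarmonicZ ϱ a b w ψ P) : IsTruncHarmonicZ ϱ a b w (φ - ψ) P := by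
  intro x hx
  have h1 := (hφ x hx).sub (hψ x hx)
  rw [sub_zero] at h1
  convert h1 using 1
  funext y
  simp only [Pi.sub_apply]
  split_ifs
  · exact (sub_zero _).symm
  · rw [sub_sub_sub_comm, map_sub]

/-- ★ **IN-PLANE TRANSLATION INVARIANCE**: the in-plane translate `τ_E φ` (`E.2 = 0`) of a `ϱ`-truncated-harmonic field on `P` is
`ϱ`-truncated-harmonic on `P − E` — the kernel and the physical cut-off see the in-plane cell only through differences. [this file, g57] -/
theorem isTruncHarmonicZ_latShift {ϱ : ℝ} {φ : Cell 2 → ℤ → E3} {P : Set (Cell 2 × ℤ)} (h : IsTruncHarmonicZ ϱ a b w φ P)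
    {E : Cell 2 × ℤ} (hE : E.2 = 0) : IsTruncHarmonicZ ϱ a b w (latShift E φ) {x | x + E ∈ P} := by
  intro x hx
  have h1 := h (x + E) hx
  rw [← Equiv.hasSum_iff (Equiv.addRight E)] at h1
  convert h1 using 1
  funext y
  simp only [Function.comp_apply, Equiv.coe_addRight, latShift, Prod.fst_add, Prod.snd_add, hE, add_zero,
    add_sub_add_right_eq_sub, lsite_add_sub_lsite_add]

/-- index balls are monotone in the radius. [formal bookkeeping] -/
theorem idxBall_mono (x₀ : Cell 2 × ℤ) {m n : ℝ} (h : m ≤ n) : idxBall x₀ m ⊆ idxBall x₀ n :=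
  fun _ hX => le_trans (show dist _ x₀ ≤ m from hX) h

/-- a step of index size `≤ k` from the ball of radius `n − k` stays in the ball of radius `n`. [formal bookkeeping] -/
theorem add_mem_idxBall {x₀ X E : Cell 2 × ℤ} {n k : ℝ} (hEk : (idxNorm E : ℝ) ≤ k) (hX : X ∈ idxBall x₀ (n - k)) :
    X + E ∈ idxBall x₀ n := by
  have h1 : dist X x₀ ≤ n - k := hX
  have h2 : dist (X + E) X = (idxNorm E : ℝ) := by
    rw [dist_comm, dist_eq_idxNorm, add_sub_cancel_left]
  show dist (X + E) x₀ ≤ n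
  linarith [dist_triangle (X + E) X x₀]

/-- ★ the DIFFERENCE FIELD `D_E φ` of a field `ϱ`-truncated-harmonic on `idxBall x₀ n` is `ϱ`-truncated-harmonic on `idxBall x₀ (n − k)` for
every in-plane step `E` of index size `≤ k`. [this file, g57] -/
theorem isTruncHarmonicZ_latDiff {ϱ : ℝ} {φ : Cell 2 → ℤ → E3} {x₀ : Cell 2 × ℤ} {n k : ℝ} (hk : 0 ≤ k) {E : Cell 2 × ℤ} (hE : E.2 = 0)
    (hEk : (idxNorm E : ℝ) ≤ k) (h : IsTruncHarmonicZ ϱ a b w φ (idxBall x₀ n)) :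
    IsTruncHarmonicZ ϱ a b w (latDiff E φ) (idxBall x₀ (n - k)) :=
  isTruncHarmonicZ_sub (fun x hx => isTruncHarmonicZ_latShift h hE x (add_mem_idxBall hEk hx))
    (isTruncHarmonicZ_mono h (idxBall_mono x₀ (by linarith)))

/-! ### VC.3  The energy of a unit difference field is a part of the energy -/

/-- `Σ_{X ∈ idxBall x₀ m} ‖D_E φ (X)‖² ≤ idxEnergy φ (idxBall x₀ (m + 1))` for steps of index size `≤ 1`: the pairs `(X, X + E)` are bonds of the
larger ball. [this file, g57] -/
theorem sum_norm_latDiff_sq_le (x₀ : Cell 2 × ℤ) (m : ℝ) (φ : Cell 2 → ℤ → E3) {E : Cell 2 × ℤ} (hE1 : (idxNorm E : ℝ) ≤ 1) :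
    ∑ X ∈ idxBallF x₀ m, ‖latDiff E φ X.1 X.2‖ ^ 2 ≤ idxEnergy φ (idxBall x₀ (m + 1)) := by
  rw [← coe_idxBallF, idxEnergy_coe_finset]
  have hinj : Set.InjOn (fun X : Cell 2 × ℤ => ((X, X + E) : (Cell 2 × ℤ) × (Cell 2 × ℤ))) ↑(idxBallF x₀ m) :=
    fun X _ Y _ h => (Prod.ext_iff.mp h).1
  have e1 : ∑ X ∈ idxBallF x₀ m, ‖latDiff E φ X.1 X.2‖ ^ 2 =
      ∑ x ∈ (idxBallF x₀ m).image (fun X => ((X, X + E) : (Cell 2 × ℤ) × (Cell 2 × ℤ))), ‖φ x.2.1 x.2.2 - φ x.1.1 x.1.2‖ ^ 2 := by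
    rw [Finset.sum_image hinj]
    exact Finset.sum_congr rfl fun X _ => rfl
  rw [e1]
  refine Finset.sum_le_sum_of_subset_of_nonneg (fun x hx => ?_) fun x _ _ => sq_nonneg _
  obtain ⟨X, hX, rfl⟩ := Finset.mem_image.mp hx
  have hXm : dist X x₀ ≤ m := mem_idxBallF.mp hX
  have hd : dist X (X + E) = (idxNorm E : ℝ) := by
    rw [dist_eq_idxNorm, add_sub_cancel_left]
  have hd' : dist (X + E) x₀ ≤ m + 1 := by
    have := dist_triangle (X + E) X x₀
    rw [dist_comm (X + E) X] at this
    linarith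
  refine Finset.mem_filter.mpr ⟨Finset.mem_product.mpr ⟨mem_idxBallF.mpr (by linarith), mem_idxBallF.mpr hd'⟩, ?_⟩
  show dist X (X + E) ≤ 1
  rw [hd]
  exact hE1

/-! ### VC.4  ★★ The tangential `H²` estimate, uniform over certified laminates -/

/-- ★★ **CACCIOPPOLI FOR IN-PLANE DIFFERENCES** (discrete tangential `H²` interior estimate): for every co-Lipschitz constant `c` and coercivity
constant `κ₀` there is a range `ϱ_C(c, κ₀) ≥ 1` beyond which, for every `κ₀`-coercive `c`-co-Lipschitz layered crystal, every IN-PLANE step `E`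
(`E.2 = 0`) of index size `≤ 1`, all radii `r < n` and every field `φ` that is `ϱ`-truncated-harmonic on `idxBall x₀ (n + 1)`,
`κ₀ · idxEnergy (D_E φ) (idxBall x₀ r) ≤ 54·F(c)·(n − r)⁻² · idxEnergy φ (idxBall x₀ (n + ϱ/c + 1))`.
Second in-plane differences are paid for by first differences one scale up; the estimate ITERATES in-plane (apply it to `D_E φ`).
[giaquinta1984 Ch. II §2, Ch. III §2] in lattice form; parts UZ (`caccioppoli_idxBall`, `v = 0`) + VC.2–VC.3. [this file, g57] -/
theorem caccioppoli_latDiff (hc : 0 < c) {κ₀ : ℝ} (hκ₀ : 0 < κ₀) :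
    ∃ ϱC : ℝ, 1 ≤ ϱC ∧ ∀ ϱ : ℝ, ϱC ≤ ϱ → ∀ (a b : E3) (w : ℤ → E3), IsLayeredCrystal c a b w → CoerciveZ (layeredKernel a b w) κ₀ →
      ∀ E : Cell 2 × ℤ, E.2 = 0 → (idxNorm E : ℝ) ≤ 1 →
        ∀ (x₀ : Cell 2 × ℤ) (r n : ℝ), r < n → ∀ φ : Cell 2 → ℤ → E3, IsTruncHarmonicZ ϱ a b w φ (idxBall x₀ (n + 1)) →
          κ₀ * idxEnergy (latDiff E φ) (idxBall x₀ r) ≤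
            54 * kernelConst c * ((n - r)⁻¹) ^ 2 * idxEnergy φ (idxBall x₀ (n + ϱ / c + 1)) := by
  obtain ⟨ϱC, hϱC, h⟩ := caccioppoli_idxBall (c := c) hc hκ₀
  refine ⟨ϱC, hϱC, fun ϱ hϱ a b w hL hK E hE hE1 x₀ r n hrn φ hφ => ?_⟩
  have hD : IsTruncHarmonicZ ϱ a b w (latDiff E φ) (idxBall x₀ n) := by
    have := isTruncHarmonicZ_latDiff zero_le_one hE hE1 hφ
    rwa [add_sub_cancel_right] at this
  have h1 := h ϱ hϱ a b w hL hK x₀ r n hrn (latDiff E φ) hD 0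
  simp only [sub_zero] at h1
  have hF := kernelConst_nonneg hc
  exact h1.trans (mul_le_mul_of_nonneg_left (sum_norm_latDiff_sq_le x₀ (n + ϱ / c) φ hE1) (by positivity))

/-- ★★ **the same MODULO MODES**: the right-hand side may be replaced by the energy of `φ − M` for every `ϱ`-truncated mode `M` (`D_E M` is a
constant, `φ − M` is again `ϱ`-truncated-harmonic) — the tangential `H²` estimate in the EXCESS currency of (LD). [this file, g57] -/
theorem caccioppoli_latDiff_modal (hc : 0 < c) {κ₀ : ℝ} (hκ₀ : 0 < κ₀) :
    ∃ ϱC : ℝ, 1 ≤ ϱC ∧ ∀ ϱ : ℝ, ϱC ≤ ϱ → ∀ (a b : E3) (w : ℤ → E3), IsLayeredCrystal c a b w → CoerciveZ (layeredKernel a b w) κ₀ →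
      ∀ E : Cell 2 × ℤ, E.2 = 0 → (idxNorm E : ℝ) ≤ 1 →
        ∀ (x₀ : Cell 2 × ℤ) (r n : ℝ), r < n → ∀ φ : Cell 2 → ℤ → E3, IsTruncHarmonicZ ϱ a b w φ (idxBall x₀ (n + 1)) →
          ∀ M : Cell 2 → ℤ → E3, IsTruncMode ϱ a b w M →
            κ₀ * idxEnergy (latDiff E φ) (idxBall x₀ r) ≤
              54 * kernelConst c * ((n - r)⁻¹) ^ 2 * idxEnergy (φ - M) (idxBall x₀ (n + ϱ / c + 1)) := by
  obtain ⟨ϱC, hϱC, h⟩ := caccioppoli_latDiff (c := c) hc hκ₀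
  refine ⟨ϱC, hϱC, fun ϱ hϱ a b w hL hK E hE hE1 x₀ r n hrn φ hφ M hM => ?_⟩
  have hφM : IsTruncHarmonicZ ϱ a b w (φ - M) (idxBall x₀ (n + 1)) :=
    isTruncHarmonicZ_sub hφ (isTruncHarmonicZ_mono hM.2.2 (Set.subset_univ _))
  have h1 := h ϱ hϱ a b w hL hK E hE hE1 x₀ r n hrn (φ - M) hφM
  rwa [idxEnergy_latDiff_sub_isAffine φ hM.1 hE] at h1

end InPlaneShift

end Summit.AtomisticToContinuum.Crystallization.Theorems.ChartedZeroExcessLayeredLatticeLiouville
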